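import Summits.RiemannHypothesis.RiemannHypothesis.Theorems.JensenPolynomialsFarGumbelAssembly
import Literature.NumberTheory.LFunctions.DeBruijnPhiComplexHead
import Mathlib.Analysis.SpecialFunctions.Trigonometric.Bounds

/-!
# Route `JensenPolynomials`, FAR crux `XiWindowZeroFreeRelFar` (B1-rel far) — S3 pointwise input (R5): the amplitude
`Q = Φ_C/Φ₁` is `1` up to `e^{−4(υ−2)}` on the saddle line (RH-FREE; cell rh-jensen, HUMAN RULING D-0040)

For hypothesis (Q) of `FarGumbel.laplaceFar_of_pointwise` (`JensenPolynomialsFarGumbelAssembly.lean`, item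
`stmt-RiemannHypothesis-19465`, stub S3): on the line `u = x + iy`, `x ≥ υ − 2 ≥ 0`, `|y| ≤ 1/10`,
`‖Φ_C(u)/Φ₁(u) − 1‖ ≤ e^{−4(υ−2)}` (`norm_phiRatio_sub_one_le`; `Φ₁ = phiHead = 2π²e^{9u}e^{−πe^{4u}}`). Ingredients: eng-5 g3's
head dominance `‖Φ_C/a₁ − 1‖ ≤ 92e^{−3Y_c}` (`Literature…norm_deBruijnPhiC_div_head_sub_one_le`, `a₁ = deBruijnPhiSummandC 0`,
`Y_c = πe^{4x}cos 4y`), the exact ratio `a₁/Φ₁ = 1 − (3/2π)e^{−4u}`, and `Y_c ≥ 2.8e^{4x} ≥ 4x + 5` on the line.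
WHAT THIS IS NOT: an explicit inequality for the kernel; nothing here bears on the zeros of `ζ` or the truth of RH.
-/

noncomputable section
-- D-0017: `Summit.RiemannHypothesis.RiemannHypothesis.…` duplicates the namespace BY DESIGN (single-problem summit).
set_option linter.dupNamespace false

namespace Summit.RiemannHypothesis.RiemannHypothesis.Theorems.JensenPolynomials.FarGumbel

open Literature.NumberTheory.LFunctions Complex
open scoped Real

/-- The exact ratio of the two heads: `a₁(u) = Φ₁(u)·(1 − (3/(2π))e^{−4u})`. -/
theorem deBruijnPhiSummandC_zero_eq (u : ℂ) :
    deBruijnPhiSummandC 0 u = phiHead u * (1 - (3 / (2 * (π : ℂ))) * Complex.exp (-4 * u)) := by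
  have hπ : (π : ℂ) ≠ 0 := by exact_mod_cast Real.pi_ne_zero
  have h5 : Complex.exp (5 * u) = Complex.exp (9 * u) * Complex.exp (-4 * u) := by
    rw [← Complex.exp_add]; ring_nf
  unfold deBruijnPhiSummandC phiHead
  push_cast
  simp only [zero_add, one_pow, mul_one]
  rw [h5]
  field_simp
  try ring

/-- `cos(4y) ≥ 23/25` for `|y| ≤ 1/10`. -/
theorem cos_four_mul_ge {y : ℝ} (hy : |y| ≤ 1 / 10) : (23 / 25 : ℝ) ≤ Real.cos (4 * y) := by
  have h := Real.one_sub_sq_div_two_le_cos (x := 4 * y)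
  have hy2 : (4 * y) ^ 2 ≤ 4 / 25 := by have := abs_le.mp hy; nlinarith
  linarith

/-- **(R5) The amplitude on the saddle line.** For `υ ≥ 189/20`, `x ≥ υ − 2`, `|y| ≤ 1/10` and `u = x + iy`:
`‖Φ_C(u)/Φ₁(u) − 1‖ ≤ e^{−4(υ−2)}`. -/
theorem norm_phiRatio_sub_one_le {υ x y : ℝ} (hυ : (189 / 20 : ℝ) ≤ υ) (hx : υ - 2 ≤ x) (hy : |y| ≤ 1 / 10) :
    ‖deBruijnPhiC ((x : ℂ) + y * I) / phiHead ((x : ℂ) + y * I) - 1‖ ≤ Real.exp (-4 * (υ - 2)) := by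
  set u : ℂ := (x : ℂ) + y * I with hu
  have hure : u.re = x := by simp [hu]
  have huim : u.im = y := by simp [hu]
  have hx0 : 0 ≤ x := by linarith
  have hyπ : |u.im| < π / 8 := by rw [huim]; linarith [abs_le.mp hy |>.2, Real.pi_gt_three, abs_nonneg y]
  have hcos : (23 / 25 : ℝ) ≤ Real.cos (4 * u.im) := by rw [huim]; exact cos_four_mul_ge hy
  have hE : 1 + 4 * x ≤ Real.exp (4 * x) := by linarith [Real.add_one_le_exp (4 * x)]
  -- `Y_c ≥ 4x + 5 ≥ 2`
  have hY : 4 * x + 5 ≤ π * Real.exp (4 * u.re) * Real.cos (4 * u.im) := by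
    rw [hure]
    have h1 : (3 : ℝ) * (1 + 4 * x) * (23 / 25) ≤ π * Real.exp (4 * x) * Real.cos (4 * (x + y * I : ℂ).im) := by
      have := Real.pi_gt_three
      have hc' : (23 / 25 : ℝ) ≤ Real.cos (4 * (x + y * I : ℂ).im) := by simpa [hu] using hcos
      gcongr
    nlinarith
  have hY2 : 2 ≤ π * Real.exp (4 * u.re) * Real.cos (4 * u.im) := by linarith
  -- eng-5 g3's head dominance
  have hhead := norm_deBruijnPhiC_div_head_sub_one_le u hyπ (by rw [hure]; exact hx0) hY2
  -- the head ratio `κ = (3/(2π))e^{−4u}`, `‖κ‖ ≤ e^{−4x}/2`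
  set κ : ℂ := (3 / (2 * (π : ℂ))) * Complex.exp (-4 * u) with hκ
  have hκn : ‖κ‖ ≤ Real.exp (-4 * x) / 2 := by
    rw [hκ, norm_mul, Complex.norm_exp]
    have : ‖(3 : ℂ) / (2 * (π : ℂ))‖ = 3 / (2 * π) := by
      rw [norm_div]; simp [abs_of_pos Real.pi_pos]
    rw [this, show (-4 * u).re = -4 * x by simp [hure]]
    rw [div_mul_eq_mul_div, div_le_div_iff₀ (by positivity) (by norm_num)]
    nlinarith [Real.pi_gt_three, Real.exp_pos (-4 * x)]
  have hexle : Real.exp (-4 * x) ≤ 1 := by rw [Real.exp_le_one_iff]; linarith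
  have hκ1 : ‖κ‖ < 1 := by linarith
  have h1κ : (1 : ℂ) - κ ≠ 0 := by
    intro h
    have hk : κ = 1 := by linear_combination -h
    rw [hk, norm_one] at hκ1
    exact lt_irrefl _ hκ1
  have hA : deBruijnPhiSummandC 0 u = phiHead u * (1 - κ) := by rw [hκ]; exact deBruijnPhiSummandC_zero_eq u
  have hP := phiHead_ne_zero u
  have hhead_ne : deBruijnPhiSummandC 0 u ≠ 0 := by rw [hA]; exact mul_ne_zero hP h1κ
  -- `Φ_C/Φ₁ − 1 = (Φ_C/a₁ − 1)(1 − κ) − κ`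
  have hid : deBruijnPhiC u / phiHead u - 1 =
      (deBruijnPhiC u / deBruijnPhiSummandC 0 u - 1) * (1 - κ) - κ := by
    rw [hA]
    field_simp
    ring
  rw [hid]
  -- sizes
  have hex1 : Real.exp (-4 * x) ≤ Real.exp (-4 * (υ - 2)) := Real.exp_monotone (by linarith)
  have h3Y : 92 * Real.exp (-(3 * (π * Real.exp (4 * u.re) * Real.cos (4 * u.im)))) ≤ Real.exp (-4 * x) / 4 := by
    -- `92 e^{−3Y} ≤ 92 e^{−12x−15} ≤ e^{−4x}/4` since `92·4 ≤ e^{15}`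
    have h1 : Real.exp (-(3 * (π * Real.exp (4 * u.re) * Real.cos (4 * u.im)))) ≤ Real.exp (-12 * x - 15) :=
      Real.exp_monotone (by linarith)
    have h2 : Real.exp (-12 * x - 15) = Real.exp (-4 * x) * (Real.exp (-8 * x) * Real.exp (-15)) := by
      rw [← Real.exp_add, ← Real.exp_add]; ring_nf
    have h3 : Real.exp (-8 * x) ≤ 1 := by rw [Real.exp_le_one_iff]; linarith
    have h4 : Real.exp (-15) * 368 ≤ 1 := by
      have hinv : Real.exp 15 * Real.exp (-15) = 1 := by rw [← Real.exp_add]; simp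
      -- `e^{15} = (e^5)^3 ≥ 18.5^3 > 368`
      have h5 : (37 / 2 : ℝ) ≤ Real.exp 5 := by
        have := Real.quadratic_le_exp_of_nonneg (by norm_num : (0:ℝ) ≤ 5); linarith
      have h15 : Real.exp 15 = Real.exp 5 ^ 3 := by rw [← Real.exp_nat_mul]; norm_num
      have h3 : (37 / 2 : ℝ) ^ 3 ≤ Real.exp 5 ^ 3 := pow_le_pow_left₀ (by norm_num) h5 3
      nlinarith [Real.exp_pos (-15)]
    calc 92 * Real.exp (-(3 * (π * Real.exp (4 * u.re) * Real.cos (4 * u.im))))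
        ≤ 92 * (Real.exp (-4 * x) * (Real.exp (-8 * x) * Real.exp (-15))) := by rw [← h2]; gcongr
      _ ≤ 92 * (Real.exp (-4 * x) * (1 * Real.exp (-15))) := by gcongr
      _ ≤ Real.exp (-4 * x) / 4 := by nlinarith [Real.exp_pos (-4 * x)]
  calc ‖(deBruijnPhiC u / deBruijnPhiSummandC 0 u - 1) * (1 - κ) - κ‖
      ≤ ‖(deBruijnPhiC u / deBruijnPhiSummandC 0 u - 1) * (1 - κ)‖ + ‖κ‖ := norm_sub_le _ _
    _ = ‖deBruijnPhiC u / deBruijnPhiSummandC 0 u - 1‖ * ‖1 - κ‖ + ‖κ‖ := by rw [norm_mul]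
    _ ≤ (Real.exp (-4 * x) / 4) * (1 + Real.exp (-4 * x) / 2) + Real.exp (-4 * x) / 2 := by
        gcongr
        · exact hhead.trans h3Y
        · calc ‖1 - κ‖ ≤ ‖(1 : ℂ)‖ + ‖κ‖ := norm_sub_le _ _
            _ ≤ 1 + Real.exp (-4 * x) / 2 := by rw [norm_one]; linarith
    _ ≤ Real.exp (-4 * x) := by nlinarith [Real.exp_pos (-4 * x)]
    _ ≤ Real.exp (-4 * (υ - 2)) := hex1

end Summit.RiemannHypothesis.RiemannHypothesis.Theorems.JensenPolynomials.FarGumbel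

end
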